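import Summits.AtomisticToContinuum.HydrodynamicLimit.Theses.OneFlightGossipEngine
import Summits.AtomisticToContinuum.HydrodynamicLimit.Theorems.OneFlightGossipEngineKineticCurrentsWindowLDUniformWindowRenyiOfTransport
import Summits.AtomisticToContinuum.HydrodynamicLimit.Theorems.OneFlightGossipEngineKineticCurrentsWindowLDUniformEntropyQuasiInvariance
import Summits.AtomisticToContinuum.HydrodynamicLimit.Theorems.OneFlightGossipEngineKineticCurrentsWindowLDUniformMarginalEntropyLedger
import Literature.MathematicalPhysics.KineticTheory.HardSphereEulerProofs
import Literature.Analysis.FluidPDE.CollisionalTransfer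
import HarnessLib

/-!
# Root-kinetic-entropy propagation of local equilibrium over a kinetic window FROM transport tightness
# (registered helper stub `stub_localEquilibriumPropagation_of_transport` of line
# `local-gibbs-entropy-ledger`, crux `KineticCurrentsWindowLDUniform`, stmt-AtomisticToContinuum-14662)

Let `λ = λ^N` be the local Gibbs law of `N + 1` hard spheres at reduced density `0 < σ ≤ 1/2` with
continuous positive profiles `(a, θ₀, u₀)`, `Φ = Φ^N` a hard-sphere flow and, for a window time `r`,
`f̄_r = (N+1)⁻¹ ∑ᵢ λ ∘ (z ↦ (Φ_r z)ᵢ)⁻¹` the averaged one-body marginal of the transported law. The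
line's residual S6 (`stub_integratedKineticEntropyBound`) at tilt `β = 0` asks that `f̄_r` stay
fibrewise Maxwellian-close in ROOT kinetic relative entropy:
`𝒦(f̄_r) = ∫ (inf_{u, θ>0} KL(f̄_r(·|x) ‖ N(u, θ id)))^{1/2} f̄_r.fst(dx) ≤ ε'` over the kinetic window
`r ∈ [0, τ(N+1)^{-1/3}]`, for all large `N`. This file shows that it is IMPLIED by the other residual,
the kinetic-window transport tightness S4'' (the hypothesis of `stub_windowRenyi_of_transport`), so the
two open residuals of the line overlap consistently.

Chain (every ingredient is landed in this namespace):
* S4'' ⇒ Rényi quasi-invariance of `λ` over the window (`stub_windowRenyi_of_transport`) ⇒ entropy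
  quasi-invariance `KL((Φ_r)_* P ‖ λ) ≤ c KL(P ‖ λ) + δ(N+1)` (`stub_entropyQuasiInvariance_of_renyi`);
  at `P = λ` this is `KL((Φ_r)_* λ ‖ λ) ≤ δ(N+1)` (`klDiv_self`);
* the marginal entropy ledger (`stub_marginalEntropyLedger`) at `P = (Φ_r)_* λ`:
  `(N+1) 𝓗(f̄_r) ≤ KL((Φ_r)_* λ ‖ λ)`, `𝓗(f̄) = ∫ KL(f̄(·|x) ‖ N(u₀(x), θ₀(x) id)) f̄.fst(dx)`, whence
  `𝓗(f̄_r) ≤ δ`;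
* pointwise `inf_{u,θ} ≤` the value at `(u₀(x), θ₀(x))`, monotonicity of `t ↦ t^{1/2}`, and the
  Cauchy–Schwarz inequality `∫ g^{1/2} dμ ≤ (∫ g dμ)^{1/2}` for the probability measure `f̄_r.fst`
  (`lep_lintegral_rpow_half_le`, from `ENNReal.lintegral_mul_le_Lp_mul_Lq` with `p = q = 2`; the
  integrand `x ↦ KL(f̄(·|x) ‖ N(u₀(x), θ₀(x) id))` is measurable by `obl_measurable_klDiv_gauss`) give
  `𝒦(f̄_r) ≤ √δ = ε'` for the choice `δ = ε'²`.
-/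

noncomputable section

open MeasureTheory Set Filter InformationTheory ProbabilityTheory
open scoped ENNReal Topology

namespace Summit.AtomisticToContinuum.HydrodynamicLimit.Theorems.KineticCurrentsWindowLDUniformLocalGibbs

open Literature.Analysis.FluidPDE (HardSphereFlow Config localMaxwellian canonicalDensity liouville
  energyObservable momentumObservable)
open Literature.MathematicalPhysics.KineticTheory (T3 V3 hsDiameter localGibbsLaw localGibbsMeasure
  localGibbsProfile gaussMeasure localGibbsLaw_eq isProbabilityMeasure_localGibbsLaw)

/-! ### Cauchy–Schwarz for the square root under a probability measure -/

/-- **Jensen / Cauchy–Schwarz for the square root.** For a probability measure `μ` and an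
a.e.-measurable `f : α → ℝ≥0∞`, `∫ f^{1/2} dμ ≤ (∫ f dμ)^{1/2}` (Hölder with exponents `(2, 2)`
against the constant function `1`). [folklore] -/
theorem lep_lintegral_rpow_half_le {α : Type*} [MeasurableSpace α] {μ : Measure α}
    [IsProbabilityMeasure μ] {f : α → ℝ≥0∞} (hf : AEMeasurable f μ) :
    ∫⁻ x, f x ^ (1 / 2 : ℝ) ∂μ ≤ (∫⁻ x, f x ∂μ) ^ (1 / 2 : ℝ) := by
  calc ∫⁻ x, f x ^ (1 / 2 : ℝ) ∂μ
      = ∫⁻ x, ((fun y => f y ^ (1 / 2 : ℝ)) * (fun _ => 1) : α → ℝ≥0∞) x ∂μ := by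
        simp only [Pi.mul_apply, mul_one]
    _ ≤ (∫⁻ x, (f x ^ (1 / 2 : ℝ)) ^ (2 : ℝ) ∂μ) ^ (1 / (2 : ℝ)) *
          (∫⁻ _x, (1 : ℝ≥0∞) ^ (2 : ℝ) ∂μ) ^ (1 / (2 : ℝ)) :=
        ENNReal.lintegral_mul_le_Lp_mul_Lq μ Real.HolderConjugate.two_two (hf.pow_const _)
          aemeasurable_const
    _ = (∫⁻ x, f x ∂μ) ^ (1 / 2 : ℝ) := by
        simp only [ENNReal.one_rpow, lintegral_const, measure_univ, mul_one, ← ENNReal.rpow_mul,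
          one_div, inv_mul_cancel₀ (two_ne_zero : (2 : ℝ) ≠ 0), ENNReal.rpow_one]

/-- **Propagation of local equilibrium in root kinetic entropy over a kinetic window, from kinetic-window
transport tightness** (helper stub `stub_localEquilibriumPropagation_of_transport`; the `β = 0` instance of the
line's residual `C⁺` = S6 `stub_integratedKineticEntropyBound`, pointwise in the window time and for every window
parameter `τ`). If the tested kinetic-energy and momentum fields are exponentially tight over the kinetic window under
every local Gibbs law (the open stub S4'' `stub_windowTransport`, verbatim), then for continuous positive profiles,
`0 < σ ≤ 1/2`, every flow family, every `ε' > 0` and `τ > 0`, for all large `N` and all `r ∈ [0, τ(N+1)^{-1/3}]`, the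
averaged one-body marginal `f̄_r` of the local Gibbs law transported to time `r` has density-weighted root kinetic
fibre entropy `∫ (inf_{u,θ>0} KL(f̄_r(·|x) ‖ N(u,θI)))^{1/2} f̄_r(dx) ≤ ε'`. Chain: S4'' ⇒ Rényi quasi-invariance
(`stub_windowRenyi_of_transport`, landed) ⇒ entropy quasi-invariance `KL(λ∘Φ_r⁻¹‖λ) ≤ δ(N+1)` at `P = λ`
(`stub_entropyQuasiInvariance_of_renyi`, landed; `klDiv_self`) ⇒ `(N+1)·𝓗(f̄_r) ≤ δ(N+1)` (marginal ledger
`stub_marginalEntropyLedger`, landed, at `P = λ.map Φ_r`, `localGibbsLaw_eq`) ⇒ `𝒦(f̄_r) ≤ 𝓗(f̄_r)^{1/2} ≤ √δ`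
(`iInf ≤` the value at `(u₀ x, θ₀ x)`; Cauchy–Schwarz `∫ g^{1/2} dμ ≤ (∫ g dμ)^{1/2}` for the probability `f̄_r.fst`,
`ENNReal.lintegral_mul_le_Lp_mul_Lq` with `p = q = 2` against `1`); take `δ := ε'²`. -/
theorem stub_localEquilibriumPropagation_of_transport :
    (∀ (a θ₀ : T3 → ℝ) (u₀ : T3 → V3), Continuous a → Continuous θ₀ → Continuous u₀ →
      (∀ x, 0 < a x) → (∀ x, 0 < θ₀ x) → ∀ σ : ℝ, 0 < σ → σ ≤ 1 / 2 →
      ∀ (ϑ : T3 → ℝ) (J : T3 → V3), Continuous ϑ → Continuous J →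
      ∃ s : ℝ, 0 < s ∧ ∀ τ : ℝ, 0 < τ → ∀ κ : ℝ, 0 < κ →
      ∀ Φ : (N : ℕ) →
        HardSphereFlow (Literature.Analysis.FluidPDE.Torus.geometry (Fin 3)) (hsDiameter σ N) (N + 1),
      ∃ N₀ : ℕ, ∀ N : ℕ, N₀ ≤ N → ∀ r ∈ Set.Icc (0 : ℝ) (τ * ((N : ℝ) + 1) ^ (-(1 / 3 : ℝ))),
        ∫⁻ z, ENNReal.ofReal (Real.exp (s *
            (|energyObservable ϑ ((Φ N).flow r z) - energyObservable ϑ z| +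
              |momentumObservable J ((Φ N).flow r z) - momentumObservable J z|)))
          ∂(localGibbsLaw σ a u₀ θ₀ N (Φ N)) ≤
        ENNReal.ofReal (Real.exp (κ * ((N : ℝ) + 1)))) →
    ∀ (a θ₀ : T3 → ℝ) (u₀ : T3 → V3), Continuous a → Continuous θ₀ → Continuous u₀ →
      (∀ x, 0 < a x) → (∀ x, 0 < θ₀ x) → ∀ σ : ℝ, 0 < σ → σ ≤ 1 / 2 →
      ∀ Φ : (N : ℕ) →
        HardSphereFlow (Literature.Analysis.FluidPDE.Torus.geometry (Fin 3)) (hsDiameter σ N) (N + 1),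
      ∀ ε' : ℝ, 0 < ε' → ∀ τ : ℝ, 0 < τ → ∃ N₀ : ℕ, ∀ N : ℕ, N₀ ≤ N →
      ∀ r ∈ Set.Icc (0 : ℝ) (τ * ((N : ℝ) + 1) ^ (-(1 / 3 : ℝ))),
      ∀ (fbar : Measure (T3 × V3)) [IsProbabilityMeasure fbar],
        fbar = ((N : ℝ≥0∞) + 1)⁻¹ • ∑ i : Fin (N + 1),
          (localGibbsLaw σ a u₀ θ₀ N (Φ N)).map (fun z => ((Φ N).flow r z) i) →
        ∫⁻ x, (⨅ (u : V3) (θ : ℝ) (_ : 0 < θ), klDiv (fbar.condKernel x) (gaussMeasure u θ)) ^ (1 / 2 : ℝ)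
            ∂fbar.fst ≤ ENNReal.ofReal ε' := by
  intro hT a θ₀ u₀ ha hθ hu ha0 hθ0 σ hσ hσ2 Φ ε' hε' τ hτ
  -- (1) S4'' ⇒ Rényi quasi-invariance ⇒ entropy quasi-invariance, with `δ = ε'²`
  obtain ⟨c, _hc1, hc⟩ := stub_entropyQuasiInvariance_of_renyi (stub_windowRenyi_of_transport hT)
    a θ₀ u₀ ha hθ hu ha0 hθ0 σ hσ hσ2
  obtain ⟨N₀, hN₀⟩ := hc τ hτ (ε' ^ 2) (by positivity) Φ
  refine ⟨N₀, fun N hN r hr fbar _ hf => ?_⟩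
  -- (2) entropy quasi-invariance at `P = λ`: `KL((Φ_r)_* λ ‖ λ) ≤ δ(N+1)`
  haveI : IsProbabilityMeasure (localGibbsLaw σ a u₀ θ₀ N (Φ N)) :=
    isProbabilityMeasure_localGibbsLaw ha hθ hu ha0 hθ0 hσ2 N (Φ N)
  have hE : klDiv ((localGibbsLaw σ a u₀ θ₀ N (Φ N)).map ((Φ N).flow r))
      (localGibbsLaw σ a u₀ θ₀ N (Φ N)) ≤ ENNReal.ofReal (ε' ^ 2 * ((N : ℝ) + 1)) := by
    have h := hN₀ N hN r hr (localGibbsLaw σ a u₀ θ₀ N (Φ N))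
    rwa [klDiv_self, mul_zero, zero_add] at h
  -- (3) the marginal entropy ledger at `P = (Φ_r)_* λ`
  haveI : IsProbabilityMeasure ((localGibbsLaw σ a u₀ θ₀ N (Φ N)).map ((Φ N).flow r)) :=
    Measure.isProbabilityMeasure_map ((Φ N).measurable_flow r).aemeasurable
  have hf' : fbar = ((N : ℝ≥0∞) + 1)⁻¹ • ∑ i : Fin (N + 1),
      ((localGibbsLaw σ a u₀ θ₀ N (Φ N)).map ((Φ N).flow r)).map (fun z => z i) := by
    rw [hf]
    congr 1
    refine Finset.sum_congr rfl fun i _ => ?_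
    rw [Measure.map_map (measurable_pi_apply i) ((Φ N).measurable_flow r)]
    rfl
  have hM := stub_marginalEntropyLedger a θ₀ u₀ ha hθ hu ha0 hθ0 σ hσ hσ2 N
    ((localGibbsLaw σ a u₀ θ₀ N (Φ N)).map ((Φ N).flow r)) fbar hf'
  rw [← localGibbsLaw_eq σ a u₀ θ₀ N (Φ N)] at hM
  -- hence `𝓗(f̄_r) ≤ δ`
  have hH : ∫⁻ x, klDiv (fbar.condKernel x) (gaussMeasure (u₀ x) (θ₀ x)) ∂fbar.fst ≤
      ENNReal.ofReal (ε' ^ 2) := by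
    have hN0 : ((N : ℝ≥0∞) + 1) ≠ 0 := by positivity
    have hNt : ((N : ℝ≥0∞) + 1) ≠ ⊤ :=
      ENNReal.add_ne_top.2 ⟨ENNReal.natCast_ne_top N, ENNReal.one_ne_top⟩
    rw [← ENNReal.mul_le_mul_iff_right hN0 hNt]
    refine (hM.trans hE).trans_eq ?_
    rw [ENNReal.ofReal_mul (sq_nonneg _), ENNReal.ofReal_add N.cast_nonneg zero_le_one,
      ENNReal.ofReal_natCast, ENNReal.ofReal_one, mul_comm]
  -- (4)–(6) `inf ≤` the value at `(u₀ x, θ₀ x)`, monotonicity of `t ↦ t^{1/2}`, Cauchy–Schwarz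
  have hGm : Measurable fun x => klDiv (fbar.condKernel x) (gaussMeasure (u₀ x) (θ₀ x)) :=
    obl_measurable_klDiv_gauss hθ.measurable hu.measurable fbar.condKernel
  calc ∫⁻ x, (⨅ (u : V3) (θ : ℝ) (_ : 0 < θ), klDiv (fbar.condKernel x) (gaussMeasure u θ)) ^
          (1 / 2 : ℝ) ∂fbar.fst
      ≤ ∫⁻ x, (klDiv (fbar.condKernel x) (gaussMeasure (u₀ x) (θ₀ x))) ^ (1 / 2 : ℝ) ∂fbar.fst :=
        lintegral_mono fun x => ENNReal.rpow_le_rpow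
          (iInf_le_of_le (u₀ x) <| iInf_le_of_le (θ₀ x) <| iInf_le _ (hθ0 x)) (by norm_num)
    _ ≤ (∫⁻ x, klDiv (fbar.condKernel x) (gaussMeasure (u₀ x) (θ₀ x)) ∂fbar.fst) ^ (1 / 2 : ℝ) :=
        lep_lintegral_rpow_half_le hGm.aemeasurable
    _ ≤ ENNReal.ofReal (ε' ^ 2) ^ (1 / 2 : ℝ) := ENNReal.rpow_le_rpow hH (by norm_num)
    _ = ENNReal.ofReal ε' := by
        rw [ENNReal.ofReal_rpow_of_nonneg (sq_nonneg _) (by norm_num), ← Real.sqrt_eq_rpow,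
          Real.sqrt_sq hε'.le]

end Summit.AtomisticToContinuum.HydrodynamicLimit.Theorems.KineticCurrentsWindowLDUniformLocalGibbs

end
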